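/-
Copyright (c) 2026 the pub-hodgecm-mathlib formalisation cell (harness21).  Prover seat hodgecm-mathlib-K2E4-p11 (g6), Track B ∕ K2-LIT, h413 = `stmt-HodgeConjecture-24833`,
line `K2_E1_TraceFormulaBeta`, campaign «5Res ENDGAME BY FAMILIES», ROADCARD §3′ (M2 v2 «SPECTRAL-MEASURE EXHAUSTION») item D1′ (dealer K2E1-plan (g7) deals (181)∕(187)∕(199)):
the commutant of a multiplication family — a bounded operator on `L²(Ω; E)` commuting with `M_s`, `s ∈ S`, commutes with `M_{𝟙_A}` for every `A ∈ σ(S)`.  Mathlib only, over ★ D1′-A.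
-/
import Summits.HodgeConjecture.HodgeConjecture.Theorems.K2E1LinftyCommutantCalculusL2   -- ★ D1′-A (this seat): the `L∞`-module calculus of the commutant (sums, products, bounded limits, polynomials, `𝟙_{s<c}`)
import Mathlib.MeasureTheory.Function.L2Space
import HarnessLib

/-!
# D1′ — `K2E1CommutantOfMultiplicationFamily`: `Q M_s = M_s Q` (`s ∈ S`) ⟹ `Q M_{𝟙_A} = M_{𝟙_A} Q` for every `A ∈ σ(S)`; and for a symmetric `Q`: complex multipliers reduce to
# their real and imaginary parts (Mathlib only)

Track B ∕ K2-LIT, crux h413 = `stmt-HodgeConjecture-24833`, route of record `HCCMUnconditional`; cell `hodgecm-mathlib`, squad K2, ENGINE E1; ROADCARD §3′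
`K2/K2E1-plan/g7/ROADCARD-5Res-FAMILIES-M2v2.K2E1-plan-g7.md` item D1′, second file (dealer (199): «design A+B "="; add the self-adjoint ⇒ `conj`∕`re`∕`im` corollary»).  THEOREMS ONLY
(no `def`, no `instance`, no `notation`, no `sorry`; default heartbeats); lane `--supports stmt-HodgeConjecture-24833 --as helper` (count-neutral).  Pure
measure theory ∕ functional analysis — no automorphic object.  Currency and ELABORATION NOTE as ★ D1′-A (local instance binder `[ENNReal.HolderTriple ∞ 2 2]`).

THE MATHEMATICS ([Rudin1991, Thm 12.22, §12.24]; [ReedSimonI1980, §VII.2–VII.3]; used in [MoeglinWaldspurger1995, IV.3.12 (b)] ∕ ROADCARD §3′.1: the projection `P_π` onto an irreducible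
`π ≤ (L²_cusp)ᗮ` commutes with the `R(h)`, hence — transported by the Plancherel isometry, where the arch-central `R(h)` act by real symbols `σ_h` — with every spectral projection
`M_{𝟙_B}`, `B ∈ σ(σ_h : h ∈ S)`).  Let `Q` be a bounded operator on `L²(Ω; E)` commuting with `M_s` for every `s` in a family `S` of bounded measurable REAL functions.  By ★ D1′-A, `Q`
commutes with every `M_{𝟙_{s<c}}`.  The sets `A` with `Q M_{𝟙_A} = M_{𝟙_A} Q` form a DYNKIN SYSTEM (§6: `∅`; complements `𝟙_{Aᶜ} = 1 − 𝟙_A`; countable disjoint unions as bounded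
pointwise limits of the finite partial unions, ★ D1′-A `commute_toLp_of_tendsto`) containing the π-SYSTEM generated by the sub-level sets (intersections are products, ★ D1′-A
`commute_toLp_mul`); by Dynkin's π-λ theorem (Mathlib `MeasurableSpace.induction_on_inter` over `generatePiSystem`) it contains `σ(S)` (§7 HEAD).  §8 (dealer (199)): on `L²(Ω; F)`, `F` a
Hilbert space, `M_g^* = M_{ḡ}` (`⟪g•f, h⟫ = ⟪f, ḡ•h⟫`), so a SYMMETRIC `Q` (`⟪Qu, v⟫ = ⟪u, Qv⟫`, e.g. an orthogonal projection) commuting with `M_g` for a bounded COMPLEX `g` commutes with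
`M_{ḡ}`, hence with `M_{re g} = ½(M_g + M_{ḡ})` and `M_{im g} = (i∕2)(M_{ḡ} − M_g)` — so the real theorem applies to `S' = {re g, im g : g ∈ S}`.
* §0 `measurable_of_mem_family` (the generated σ-algebra is `σ(S)`).
* §6 `memLp_top_indicator`, `lpSMul_sub`, `commute_indicator_empty ∕ _compl ∕ _inter ∕ _biUnion_range ∕ _iUnion`, **`commute_indicator_of_generateFrom`** (Dynkin step, any generating family).
* §7 `generateFrom_sublevel_le`, HEAD **`commute_indicator_of_measurableSet_sigma`** (any `MemLp` witness of `𝟙_A`) and **`commute_indicator_of_measurableSet_sigma'`** (canonical class).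
* §8 `memLp_top_conj`, `inner_toLp_smul_left` (`M_g^* = M_{ḡ}`), **`commute_toLp_conj_of_symmetric`**, `memLp_top_re ∕ _im`, **`commute_toLp_re_of_symmetric`**, **`commute_toLp_im_of_symmetric`**.
HONEST LABEL: HC_CM is proved only modulo the 7 printed citations (2 remaining named inputs: hLiu418 = `stmt-HodgeConjecture-24832`, h413 = `stmt-HodgeConjecture-24833`) until rung 0
closes; this file asserts no named fact, closes no socket; count-neutral; letter-free, Mathlib-only over ★ D1′-A.

## References
* [Rudin1991] W. Rudin, *Functional Analysis* (2nd ed., 1991), Thm 12.22, §12.24.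
* [ReedSimonI1980] M. Reed, B. Simon, *Methods of Modern Mathematical Physics I: Functional Analysis* (rev. ed. 1980), §VII.2–VII.3.
* [MoeglinWaldspurger1995] C. Mœglin, J.-L. Waldspurger, *Spectral decomposition and Eisenstein series* (1995), IV.3.12.
-/

set_option autoImplicit false
set_option linter.dupNamespace false  -- the mandated namespace repeats the summit's segment (`HodgeConjecture.HodgeConjecture`)

noncomputable section

open MeasureTheory Set Filter Topology MeasurableSpace
open scoped ENNReal InnerProductSpace
open Summit.HodgeConjecture.HodgeConjecture.Cruxes.H413.K2E1LinftyCommutantCalculusL2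

namespace Summit.HodgeConjecture.HodgeConjecture.Cruxes.H413.K2E1CommutantOfMultiplicationFamily

/-! ## §0 The σ-algebra `σ(S)` generated by the sub-level sets of a family of real functions -/

section Aux

variable {Ω' : Type*}

/-- Every member of `S` is measurable for the σ-algebra generated by the sub-level sets `{s < c}` (`s ∈ S`, `c ∈ ℝ`): it IS `σ(S)`. [folklore] -/
theorem measurable_of_mem_family {S : Set (Ω' → ℝ)} {s : Ω' → ℝ} (hs : s ∈ S) :
    Measurable[generateFrom {B : Set Ω' | ∃ s ∈ S, ∃ c : ℝ, B = {x | s x < c}}] s := by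
  letI : MeasurableSpace Ω' := generateFrom {B : Set Ω' | ∃ s ∈ S, ∃ c : ℝ, B = {x | s x < c}}
  exact measurable_of_Iio fun c => measurableSet_generateFrom ⟨s, hs, c, rfl⟩

end Aux

variable {Ω : Type*} [MeasurableSpace Ω] {m : Measure Ω} {𝕜 : Type*} [RCLike 𝕜] {E : Type*} [NormedAddCommGroup E] [NormedSpace 𝕜 E]
variable [ENNReal.HolderTriple ∞ 2 2]
/-! ## §6 Indicators: the commuting sets form a Dynkin system containing every generated π-system -/

section Indicators

variable (Q : Lp E 2 m →L[𝕜] Lp E 2 m)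

omit [ENNReal.HolderTriple ∞ 2 2] in
/-- The indicator of a measurable set is a bounded measurable multiplier. [folklore] -/
theorem memLp_top_indicator {A : Set Ω} (hA : MeasurableSet A) : MemLp (A.indicator fun _ : Ω => (1 : 𝕜)) ∞ m :=
  memLp_top_of_bound (aestronglyMeasurable_const.indicator hA) 1 (Eventually.of_forall fun x => (norm_indicator_le_norm_self _ _).trans (by rw [norm_one]))

/-- `(φ − ψ) • f = φ • f − ψ • f` for the Hölder action. [folklore] -/
theorem lpSMul_sub (φ ψ : Lp 𝕜 ∞ m) (f : Lp E 2 m) : ((φ - ψ) • f : Lp E 2 m) = φ • f - ψ • f := by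
  rw [sub_eq_add_neg, Lp.smul_add, Lp.neg_smul, ← sub_eq_add_neg]

/-- The empty set commutes (`𝟙_∅ = 0`). [folklore] -/
theorem commute_indicator_empty (h : MemLp ((∅ : Set Ω).indicator fun _ : Ω => (1 : 𝕜)) ∞ m) (f : Lp E 2 m) :
    Q (h.toLp ((∅ : Set Ω).indicator fun _ : Ω => (1 : 𝕜)) • f) = h.toLp ((∅ : Set Ω).indicator fun _ : Ω => (1 : 𝕜)) • Q f := by
  have h0 : h.toLp ((∅ : Set Ω).indicator fun _ : Ω => (1 : 𝕜)) = (MemLp.zero : MemLp (0 : Ω → 𝕜) ∞ m).toLp (0 : Ω → 𝕜) :=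
    MemLp.toLp_congr _ _ (Eventually.of_forall fun x => by simp only [Set.indicator_empty, Pi.zero_apply])
  rw [h0, MemLp.toLp_zero, Lp.zero_smul, map_zero, Lp.zero_smul]

/-- Complements commute: `𝟙_{Aᶜ} = 1 − 𝟙_A`. [cite: Rudin1991, Thm 12.22] -/
theorem commute_indicator_compl {A : Set Ω} (hA : MeasurableSet A)
    (hQA : ∀ f : Lp E 2 m, Q ((memLp_top_indicator (𝕜 := 𝕜) (m := m) hA).toLp (A.indicator fun _ : Ω => (1 : 𝕜)) • f) =
      (memLp_top_indicator (𝕜 := 𝕜) (m := m) hA).toLp (A.indicator fun _ : Ω => (1 : 𝕜)) • Q f)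
    (h : MemLp (Aᶜ.indicator fun _ : Ω => (1 : 𝕜)) ∞ m) (f : Lp E 2 m) :
    Q (h.toLp (Aᶜ.indicator fun _ : Ω => (1 : 𝕜)) • f) = h.toLp (Aᶜ.indicator fun _ : Ω => (1 : 𝕜)) • Q f := by
  have heq : h.toLp (Aᶜ.indicator fun _ : Ω => (1 : 𝕜)) =
      (memLp_top_const (μ := m) (1 : 𝕜)).toLp (fun _ : Ω => (1 : 𝕜)) - (memLp_top_indicator (𝕜 := 𝕜) (m := m) hA).toLp (A.indicator fun _ : Ω => (1 : 𝕜)) := by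
    rw [← MemLp.toLp_sub]
    exact MemLp.toLp_congr _ _ (Eventually.of_forall fun x => by simp only [Set.indicator_compl, Pi.sub_apply])
  rw [heq, lpSMul_sub, map_sub, commute_toLp_const Q, hQA, lpSMul_sub]

/-- Intersections commute: `𝟙_{A ∩ B} = 𝟙_A · 𝟙_B`. [cite: Rudin1991, Thm 12.22] -/
theorem commute_indicator_inter {A B : Set Ω} (hA : MeasurableSet A) (hB : MeasurableSet B)
    (hQA : ∀ f : Lp E 2 m, Q ((memLp_top_indicator (𝕜 := 𝕜) (m := m) hA).toLp (A.indicator fun _ : Ω => (1 : 𝕜)) • f) =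
      (memLp_top_indicator (𝕜 := 𝕜) (m := m) hA).toLp (A.indicator fun _ : Ω => (1 : 𝕜)) • Q f)
    (hQB : ∀ f : Lp E 2 m, Q ((memLp_top_indicator (𝕜 := 𝕜) (m := m) hB).toLp (B.indicator fun _ : Ω => (1 : 𝕜)) • f) =
      (memLp_top_indicator (𝕜 := 𝕜) (m := m) hB).toLp (B.indicator fun _ : Ω => (1 : 𝕜)) • Q f)
    (h : MemLp ((A ∩ B).indicator fun _ : Ω => (1 : 𝕜)) ∞ m) (f : Lp E 2 m) :
    Q (h.toLp ((A ∩ B).indicator fun _ : Ω => (1 : 𝕜)) • f) = h.toLp ((A ∩ B).indicator fun _ : Ω => (1 : 𝕜)) • Q f := by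
  have hpt : ∀ x, (A ∩ B).indicator (fun _ : Ω => (1 : 𝕜)) x = A.indicator (fun _ : Ω => (1 : 𝕜)) x * B.indicator (fun _ : Ω => (1 : 𝕜)) x := fun x => by
    rw [← Set.inter_indicator_mul]; simp only [mul_one]
  have hprod : MemLp (fun x => A.indicator (fun _ : Ω => (1 : 𝕜)) x * B.indicator (fun _ : Ω => (1 : 𝕜)) x) ∞ m :=
    h.ae_eq (Eventually.of_forall fun x => hpt x)
  have heq : h.toLp ((A ∩ B).indicator fun _ : Ω => (1 : 𝕜)) = hprod.toLp (fun x => A.indicator (fun _ : Ω => (1 : 𝕜)) x * B.indicator (fun _ : Ω => (1 : 𝕜)) x) :=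
    MemLp.toLp_congr _ _ (Eventually.of_forall fun x => hpt x)
  rw [heq]
  exact commute_toLp_mul Q (memLp_top_indicator hA) (memLp_top_indicator hB) hprod hQA hQB f

/-- Finite unions of a pairwise disjoint commuting sequence commute (`𝟙_{⋃_{i<N+1}} = 𝟙_{⋃_{i<N}} + 𝟙_{A_N}`). [cite: Rudin1991, §12.24] -/
theorem commute_indicator_biUnion_range {A : ℕ → Set Ω} (hd : Pairwise (Function.onFun Disjoint A)) (hAm : ∀ i, MeasurableSet (A i))
    (hQA : ∀ i, ∀ f : Lp E 2 m, Q ((memLp_top_indicator (𝕜 := 𝕜) (m := m) (hAm i)).toLp ((A i).indicator fun _ : Ω => (1 : 𝕜)) • f) =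
      (memLp_top_indicator (𝕜 := 𝕜) (m := m) (hAm i)).toLp ((A i).indicator fun _ : Ω => (1 : 𝕜)) • Q f)
    (N : ℕ) (h : MemLp ((⋃ i ∈ Finset.range N, A i).indicator fun _ : Ω => (1 : 𝕜)) ∞ m) (f : Lp E 2 m) :
    Q (h.toLp ((⋃ i ∈ Finset.range N, A i).indicator fun _ : Ω => (1 : 𝕜)) • f) = h.toLp ((⋃ i ∈ Finset.range N, A i).indicator fun _ : Ω => (1 : 𝕜)) • Q f := by
  induction N generalizing f with
  | zero =>
    have h0 : h.toLp ((⋃ i ∈ Finset.range 0, A i).indicator fun _ : Ω => (1 : 𝕜)) = (MemLp.zero : MemLp (0 : Ω → 𝕜) ∞ m).toLp (0 : Ω → 𝕜) :=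
      MemLp.toLp_congr _ _ (Eventually.of_forall fun x => by simp only [Finset.range_zero, Finset.notMem_empty, Set.iUnion_of_empty, Set.iUnion_empty, Set.indicator_empty, Pi.zero_apply])
    rw [h0, MemLp.toLp_zero, Lp.zero_smul, map_zero, Lp.zero_smul]
  | succ N ih =>
    have hU : MeasurableSet (⋃ i ∈ Finset.range N, A i) := Finset.measurableSet_biUnion _ fun i _ => hAm i
    have hdisj : Disjoint (⋃ i ∈ Finset.range N, A i) (A N) := by
      rw [Set.disjoint_iUnion₂_left]
      intro i hi
      exact hd (Finset.mem_range.1 hi).ne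
    have heq : h.toLp ((⋃ i ∈ Finset.range (N + 1), A i).indicator fun _ : Ω => (1 : 𝕜)) =
        ((memLp_top_indicator (𝕜 := 𝕜) (m := m) hU).add (memLp_top_indicator (𝕜 := 𝕜) (m := m) (hAm N))).toLp
          (((⋃ i ∈ Finset.range N, A i).indicator fun _ : Ω => (1 : 𝕜)) + (A N).indicator fun _ : Ω => (1 : 𝕜)) := by
      refine MemLp.toLp_congr _ _ (Eventually.of_forall fun x => ?_)
      rw [Finset.range_add_one, Finset.set_biUnion_insert, Set.union_comm, Set.indicator_union_of_disjoint hdisj, Pi.add_apply]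
    rw [heq]
    exact commute_toLp_add Q _ _ (ih (memLp_top_indicator hU)) (hQA N) f

/-- Countable disjoint unions commute: `𝟙_{⋃ Aᵢ} = lim_N 𝟙_{⋃_{i<N} Aᵢ}` boundedly (★ D1′-A bounded-limit closure). [cite: ReedSimonI1980, §VII.3] [cite: Rudin1991, §12.24] -/
theorem commute_indicator_iUnion {A : ℕ → Set Ω} (hd : Pairwise (Function.onFun Disjoint A)) (hAm : ∀ i, MeasurableSet (A i))
    (hQA : ∀ i, ∀ f : Lp E 2 m, Q ((memLp_top_indicator (𝕜 := 𝕜) (m := m) (hAm i)).toLp ((A i).indicator fun _ : Ω => (1 : 𝕜)) • f) =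
      (memLp_top_indicator (𝕜 := 𝕜) (m := m) (hAm i)).toLp ((A i).indicator fun _ : Ω => (1 : 𝕜)) • Q f)
    (h : MemLp ((⋃ i, A i).indicator fun _ : Ω => (1 : 𝕜)) ∞ m) (f : Lp E 2 m) :
    Q (h.toLp ((⋃ i, A i).indicator fun _ : Ω => (1 : 𝕜)) • f) = h.toLp ((⋃ i, A i).indicator fun _ : Ω => (1 : 𝕜)) • Q f := by
  have hU : ∀ N, MeasurableSet (⋃ i ∈ Finset.range N, A i) := fun N => Finset.measurableSet_biUnion _ fun i _ => hAm i
  refine commute_toLp_of_tendsto Q (g := fun N x => (⋃ i ∈ Finset.range N, A i).indicator (fun _ : Ω => (1 : 𝕜)) x)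
    (fun N => memLp_top_indicator (hU N)) h (K := 1) (fun N x => (norm_indicator_le_norm_self _ _).trans (by rw [norm_one])) (fun x => ?_)
    (fun N => commute_indicator_biUnion_range Q hd hAm hQA N (memLp_top_indicator (hU N))) f
  by_cases hx : x ∈ ⋃ i, A i
  · obtain ⟨i₀, hi₀⟩ := Set.mem_iUnion.1 hx
    rw [Set.indicator_of_mem hx]
    refine tendsto_atTop_of_eventually_const (i₀ := i₀ + 1) fun N hN => ?_
    rw [Set.indicator_of_mem]
    exact Set.mem_biUnion (Finset.mem_range.2 (Nat.lt_of_succ_le hN)) hi₀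
  · rw [Set.indicator_of_notMem hx]
    have h0 : ∀ N, (⋃ i ∈ Finset.range N, A i).indicator (fun _ : Ω => (1 : 𝕜)) x = 0 := fun N =>
      Set.indicator_of_notMem (fun hx' => hx (by obtain ⟨i, -, hi⟩ := Set.mem_iUnion₂.1 hx'; exact Set.mem_iUnion.2 ⟨i, hi⟩)) _
    simp only [h0]
    exact tendsto_const_nhds

/-- **THE DYNKIN STEP**: if the indicators of a family `g` of measurable sets commute with `Q`, so do the indicators of every set of the σ-algebra generated by `g` — the commuting sets form a
Dynkin system (`∅`, complements, countable disjoint unions) containing the π-system generated by `g` (intersections), Mathlib `induction_on_inter` ∕ `generatePiSystem`.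
[cite: Rudin1991, Thm 12.22, §12.24] [cite: ReedSimonI1980, §VII.3] -/
theorem commute_indicator_of_generateFrom (g : Set (Set Ω)) (hg : ∀ A ∈ g, MeasurableSet A)
    (hQg : ∀ A ∈ g, ∀ (h : MemLp (A.indicator fun _ : Ω => (1 : 𝕜)) ∞ m) (f : Lp E 2 m), Q (h.toLp (A.indicator fun _ : Ω => (1 : 𝕜)) • f) = h.toLp (A.indicator fun _ : Ω => (1 : 𝕜)) • Q f)
    {A : Set Ω} (hA : MeasurableSet[generateFrom g] A) (h : MemLp (A.indicator fun _ : Ω => (1 : 𝕜)) ∞ m) (f : Lp E 2 m) :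
    Q (h.toLp (A.indicator fun _ : Ω => (1 : 𝕜)) • f) = h.toLp (A.indicator fun _ : Ω => (1 : 𝕜)) • Q f := by
  -- every generated set is measurable for the ambient σ-algebra
  have hle : generateFrom g ≤ ‹MeasurableSpace Ω› := generateFrom_le hg
  -- sets of the generated π-system: measurable, commuting
  have hπm : ∀ B ∈ generatePiSystem g, MeasurableSet B := by
    intro B hB
    induction hB with
    | base hs => exact hg _ hs
    | inter _ _ _ h1 h2 => exact h1.inter h2
  have hπ : ∀ B ∈ generatePiSystem g, ∀ (h : MemLp (B.indicator fun _ : Ω => (1 : 𝕜)) ∞ m) (f : Lp E 2 m),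
      Q (h.toLp (B.indicator fun _ : Ω => (1 : 𝕜)) • f) = h.toLp (B.indicator fun _ : Ω => (1 : 𝕜)) • Q f := by
    intro B hB
    induction hB with
    | base hs => exact hQg _ hs
    | @inter s t hs ht _ h1 h2 =>
      intro h f
      exact commute_indicator_inter Q (hπm s hs) (hπm t ht) (h1 _) (h2 _) h f
  -- Dynkin induction on the σ-algebra generated by the π-system
  have hA' : MeasurableSet[generateFrom (generatePiSystem g)] A := by rwa [generateFrom_generatePiSystem_eq]
  revert h f
  refine MeasurableSpace.induction_on_inter (m := generateFrom (generatePiSystem g))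
    (C := fun B _ => ∀ (h : MemLp (B.indicator fun _ : Ω => (1 : 𝕜)) ∞ m) (f : Lp E 2 m), Q (h.toLp (B.indicator fun _ : Ω => (1 : 𝕜)) • f) = h.toLp (B.indicator fun _ : Ω => (1 : 𝕜)) • Q f)
    rfl (isPiSystem_generatePiSystem g) ?_ ?_ ?_ ?_ A hA'
  · exact fun h f => commute_indicator_empty Q h f
  · exact fun B hB => hπ B hB
  · intro B hBm hB h f
    have hBa : MeasurableSet B := by
      rw [generateFrom_generatePiSystem_eq] at hBm
      exact hle _ hBm
    exact commute_indicator_compl Q hBa (hB _) h f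
  · intro B hd hBm hB h f
    have hBa : ∀ i, MeasurableSet (B i) := fun i => by
      have := hBm i
      rw [generateFrom_generatePiSystem_eq] at this
      exact hle _ this
    exact commute_indicator_iUnion Q hd hBa (fun i => hB i _) h f

end Indicators

/-! ## §7 HEAD: indicators of every set of the σ-algebra generated by the family `S` -/

section Head

variable (Q : Lp E 2 m →L[𝕜] Lp E 2 m)

omit [ENNReal.HolderTriple ∞ 2 2] in
/-- The generators `{s < c}` are measurable, so `σ(S)` is coarser than the ambient σ-algebra. [folklore] -/
theorem generateFrom_sublevel_le {S : Set (Ω → ℝ)} (hSm : ∀ s ∈ S, Measurable s) :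
    generateFrom {B : Set Ω | ∃ s ∈ S, ∃ c : ℝ, B = {x | s x < c}} ≤ ‹MeasurableSpace Ω› :=
  generateFrom_le (by rintro B ⟨s, hs, c, rfl⟩; exact measurableSet_lt (hSm s hs) measurable_const)


/-- **HEAD (D1′, indicator form).**  `S` a family of bounded measurable REAL multipliers with which the bounded operator `Q` on `L²(Ω; E)` commutes (`Q M_s = M_s Q`, `s ∈ S`).  THEN
`Q` commutes with `M_{𝟙_A}` for EVERY set `A` of the σ-algebra `σ(S)` generated by `S` (= generated by the sub-level sets `{s < c}`, `s ∈ S`, `c ∈ ℝ`): the commuting indicators form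
a Dynkin system (§6) containing the π-system generated by the `{s < c}` (★ D1′-A `commute_toLp_indicator_lt` + products). [cite: Rudin1991, Thm 12.22, §12.24] [cite: ReedSimonI1980, §VII.3] -/
theorem commute_indicator_of_measurableSet_sigma {S : Set (Ω → ℝ)} (hSm : ∀ s ∈ S, Measurable s) (hSb : ∀ s ∈ S, ∃ K : ℝ, ∀ x, |s x| ≤ K)
    (hQS : ∀ s ∈ S, ∀ (hs : MemLp (fun x => ((s x : ℝ) : 𝕜)) ∞ m) (f : Lp E 2 m),
      Q (hs.toLp (fun x => ((s x : ℝ) : 𝕜)) • f) = hs.toLp (fun x => ((s x : ℝ) : 𝕜)) • Q f)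
    {A : Set Ω} (hA : MeasurableSet[generateFrom {B : Set Ω | ∃ s ∈ S, ∃ c : ℝ, B = {x | s x < c}}] A)
    (h : MemLp (A.indicator fun _ : Ω => (1 : 𝕜)) ∞ m) (f : Lp E 2 m) :
    Q (h.toLp (A.indicator fun _ : Ω => (1 : 𝕜)) • f) = h.toLp (A.indicator fun _ : Ω => (1 : 𝕜)) • Q f := by
  refine commute_indicator_of_generateFrom Q _ ?_ ?_ hA h f
  · rintro B ⟨s, hs, c, rfl⟩
    exact measurableSet_lt (hSm s hs) measurable_const
  · rintro B ⟨s, hs, c, rfl⟩ h' f'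
    obtain ⟨K, hK⟩ := hSb s hs
    exact commute_toLp_indicator_lt Q (hSm s hs) hK (hQS s hs _) c f'

/-- **HEAD, canonical form**: the same with the ambient measurability of `A` and the canonical `L∞` class of `𝟙_A` supplied. [cite: Rudin1991, Thm 12.22, §12.24] -/
theorem commute_indicator_of_measurableSet_sigma' {S : Set (Ω → ℝ)} (hSm : ∀ s ∈ S, Measurable s) (hSb : ∀ s ∈ S, ∃ K : ℝ, ∀ x, |s x| ≤ K)
    (hQS : ∀ s ∈ S, ∀ (hs : MemLp (fun x => ((s x : ℝ) : 𝕜)) ∞ m) (f : Lp E 2 m),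
      Q (hs.toLp (fun x => ((s x : ℝ) : 𝕜)) • f) = hs.toLp (fun x => ((s x : ℝ) : 𝕜)) • Q f)
    {A : Set Ω} (hA : MeasurableSet[generateFrom {B : Set Ω | ∃ s ∈ S, ∃ c : ℝ, B = {x | s x < c}}] A) (f : Lp E 2 m) :
    Q ((memLp_top_indicator (𝕜 := 𝕜) (m := m) (generateFrom_sublevel_le hSm A hA)).toLp (A.indicator fun _ : Ω => (1 : 𝕜)) • f) =
      (memLp_top_indicator (𝕜 := 𝕜) (m := m) (generateFrom_sublevel_le hSm A hA)).toLp (A.indicator fun _ : Ω => (1 : 𝕜)) • Q f :=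
  commute_indicator_of_measurableSet_sigma Q hSm hSb hQS hA _ f

end Head

/-! ## §8 Complex multipliers and a symmetric `Q`: `Q M_g = M_g Q ⟹ Q M_{ḡ} = M_{ḡ} Q ⟹ Q M_{re g} = M_{re g} Q`, `Q M_{im g} = M_{im g} Q` -/

section Symmetric

variable {F : Type*} [NormedAddCommGroup F] [InnerProductSpace 𝕜 F]

omit [ENNReal.HolderTriple ∞ 2 2] in
/-- The conjugate of a bounded multiplier is a bounded multiplier. [folklore] -/
theorem memLp_top_conj {g : Ω → 𝕜} (hg : MemLp g ∞ m) : MemLp (fun x => (starRingEnd 𝕜) (g x)) ∞ m :=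
  hg.of_le (RCLike.continuous_conj.comp_aestronglyMeasurable hg.1) (Eventually.of_forall fun x => by rw [RCLike.norm_conj])

/-- **the adjoint of `M_g` is `M_{ḡ}`**: `⟪g • f, h⟫_𝕜 = ⟪f, ḡ • h⟫_𝕜` in `L²(Ω; F)`. [cite: ReedSimonI1980, §VII.2] -/
theorem inner_toLp_smul_left {g : Ω → 𝕜} (hg : MemLp g ∞ m) (hgc : MemLp (fun x => (starRingEnd 𝕜) (g x)) ∞ m) (f h : Lp F 2 m) :
    ⟪(hg.toLp g • f : Lp F 2 m), h⟫_𝕜 = ⟪f, (hgc.toLp (fun x => (starRingEnd 𝕜) (g x)) • h : Lp F 2 m)⟫_𝕜 := by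
  rw [L2.inner_def, L2.inner_def]
  refine integral_congr_ae ?_
  filter_upwards [Lp.coeFn_lpSMul (r := 2) (hg.toLp g) f, hg.coeFn_toLp, Lp.coeFn_lpSMul (r := 2) (hgc.toLp (fun x => (starRingEnd 𝕜) (g x))) h, hgc.coeFn_toLp]
    with x h1 h2 h3 h4
  rw [h1, Pi.smul_apply', h2, h3, Pi.smul_apply', h4, inner_smul_left, inner_smul_right]

variable (Q : Lp F 2 m →L[𝕜] Lp F 2 m)

/-- **A SYMMETRIC `Q` COMMUTING WITH `M_g` COMMUTES WITH `M_{ḡ}`** (`M_{ḡ} = M_g^*`: `⟪Q(ḡ•f), v⟫_𝕜 = ⟪f, g•Qv⟫_𝕜 = ⟪f, Q(g•v)⟫_𝕜 = ⟪ḡ•Qf, v⟫_𝕜`). [cite: ReedSimonI1980, §VII.2] [cite: Rudin1991, Thm 12.22] -/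
theorem commute_toLp_conj_of_symmetric (hQ : ∀ u v : Lp F 2 m, ⟪Q u, v⟫_𝕜 = ⟪u, Q v⟫_𝕜) {g : Ω → 𝕜} (hg : MemLp g ∞ m)
    (hQg : ∀ f : Lp F 2 m, Q (hg.toLp g • f) = hg.toLp g • Q f) (hgc : MemLp (fun x => (starRingEnd 𝕜) (g x)) ∞ m) (f : Lp F 2 m) :
    Q (hgc.toLp (fun x => (starRingEnd 𝕜) (g x)) • f) = hgc.toLp (fun x => (starRingEnd 𝕜) (g x)) • Q f := by
  have hcc : MemLp (fun x => (starRingEnd 𝕜) ((starRingEnd 𝕜) (g x))) ∞ m := memLp_top_conj hgc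
  have hgg : hcc.toLp (fun x => (starRingEnd 𝕜) ((starRingEnd 𝕜) (g x))) = hg.toLp g :=
    MemLp.toLp_congr _ _ (Eventually.of_forall fun x => RCLike.conj_conj (g x))
  refine ext_inner_right 𝕜 fun v => ?_
  calc ⟪Q (hgc.toLp (fun x => (starRingEnd 𝕜) (g x)) • f), v⟫_𝕜 = ⟪(hgc.toLp (fun x => (starRingEnd 𝕜) (g x)) • f : Lp F 2 m), Q v⟫_𝕜 := hQ _ _
    _ = ⟪f, (hg.toLp g • Q v : Lp F 2 m)⟫_𝕜 := by rw [inner_toLp_smul_left hgc hcc, hgg]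
    _ = ⟪f, Q (hg.toLp g • v)⟫_𝕜 := by rw [hQg]
    _ = ⟪Q f, (hg.toLp g • v : Lp F 2 m)⟫_𝕜 := (hQ _ _).symm
    _ = ⟪(hgc.toLp (fun x => (starRingEnd 𝕜) (g x)) • Q f : Lp F 2 m), v⟫_𝕜 := by rw [inner_toLp_smul_left hgc hcc (Q f) v, hgg]

omit [ENNReal.HolderTriple ∞ 2 2] in
/-- The real part of a bounded multiplier, embedded in `𝕜`, is a bounded multiplier. [folklore] -/
theorem memLp_top_re {g : Ω → 𝕜} (hg : MemLp g ∞ m) : MemLp (fun x => ((RCLike.re (g x) : ℝ) : 𝕜)) ∞ m :=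
  hg.of_le ((RCLike.continuous_ofReal.comp RCLike.continuous_re).comp_aestronglyMeasurable hg.1)
    (Eventually.of_forall fun x => by rw [RCLike.norm_ofReal]; exact RCLike.abs_re_le_norm (g x))

omit [ENNReal.HolderTriple ∞ 2 2] in
/-- The imaginary part of a bounded multiplier, embedded in `𝕜`, is a bounded multiplier. [folklore] -/
theorem memLp_top_im {g : Ω → 𝕜} (hg : MemLp g ∞ m) : MemLp (fun x => ((RCLike.im (g x) : ℝ) : 𝕜)) ∞ m :=
  hg.of_le ((RCLike.continuous_ofReal.comp RCLike.continuous_im).comp_aestronglyMeasurable hg.1)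
    (Eventually.of_forall fun x => by rw [RCLike.norm_ofReal]; exact RCLike.abs_im_le_norm (g x))

/-- **A SYMMETRIC `Q` COMMUTING WITH `M_g` COMMUTES WITH `M_{re g}`** (`re g = (g + ḡ)∕2`). [cite: ReedSimonI1980, §VII.2] [cite: Rudin1991, Thm 12.22] -/
theorem commute_toLp_re_of_symmetric (hQ : ∀ u v : Lp F 2 m, ⟪Q u, v⟫_𝕜 = ⟪u, Q v⟫_𝕜) {g : Ω → 𝕜} (hg : MemLp g ∞ m)
    (hQg : ∀ f : Lp F 2 m, Q (hg.toLp g • f) = hg.toLp g • Q f) (hre : MemLp (fun x => ((RCLike.re (g x) : ℝ) : 𝕜)) ∞ m) (f : Lp F 2 m) :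
    Q (hre.toLp (fun x => ((RCLike.re (g x) : ℝ) : 𝕜)) • f) = hre.toLp (fun x => ((RCLike.re (g x) : ℝ) : 𝕜)) • Q f := by
  have hgc : MemLp (fun x => (starRingEnd 𝕜) (g x)) ∞ m := memLp_top_conj hg
  have heq : hre.toLp (fun x => ((RCLike.re (g x) : ℝ) : 𝕜)) = ((2 : 𝕜)⁻¹) • (hg.add hgc).toLp (g + fun x => (starRingEnd 𝕜) (g x)) := by
    rw [← MemLp.toLp_const_smul]
    exact MemLp.toLp_congr _ _ (Eventually.of_forall fun x => by
      show ((RCLike.re (g x) : ℝ) : 𝕜) = (2 : 𝕜)⁻¹ • (g x + (starRingEnd 𝕜) (g x))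
      rw [RCLike.re_eq_add_conj, smul_eq_mul, div_eq_inv_mul])
  rw [heq, Lp.smul_assoc, map_smul, MemLp.toLp_add, Lp.smul_add, map_add, hQg, commute_toLp_conj_of_symmetric Q hQ hg hQg hgc, ← Lp.smul_add, Lp.smul_assoc]

/-- **A SYMMETRIC `Q` COMMUTING WITH `M_g` COMMUTES WITH `M_{im g}`** (`im g = i(ḡ − g)∕2`). [cite: ReedSimonI1980, §VII.2] [cite: Rudin1991, Thm 12.22] -/
theorem commute_toLp_im_of_symmetric (hQ : ∀ u v : Lp F 2 m, ⟪Q u, v⟫_𝕜 = ⟪u, Q v⟫_𝕜) {g : Ω → 𝕜} (hg : MemLp g ∞ m)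
    (hQg : ∀ f : Lp F 2 m, Q (hg.toLp g • f) = hg.toLp g • Q f) (him : MemLp (fun x => ((RCLike.im (g x) : ℝ) : 𝕜)) ∞ m) (f : Lp F 2 m) :
    Q (him.toLp (fun x => ((RCLike.im (g x) : ℝ) : 𝕜)) • f) = him.toLp (fun x => ((RCLike.im (g x) : ℝ) : 𝕜)) • Q f := by
  have hgc : MemLp (fun x => (starRingEnd 𝕜) (g x)) ∞ m := memLp_top_conj hg
  have heq : him.toLp (fun x => ((RCLike.im (g x) : ℝ) : 𝕜)) = (RCLike.I * (2 : 𝕜)⁻¹) • (hgc.sub hg).toLp ((fun x => (starRingEnd 𝕜) (g x)) - g) := by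
    rw [← MemLp.toLp_const_smul]
    exact MemLp.toLp_congr _ _ (Eventually.of_forall fun x => by
      show ((RCLike.im (g x) : ℝ) : 𝕜) = (RCLike.I * (2 : 𝕜)⁻¹) • ((starRingEnd 𝕜) (g x) - g x)
      rw [RCLike.im_eq_conj_sub, smul_eq_mul]; ring)
  rw [heq, Lp.smul_assoc, map_smul, MemLp.toLp_sub, lpSMul_sub, map_sub, hQg, commute_toLp_conj_of_symmetric Q hQ hg hQg hgc, ← lpSMul_sub, Lp.smul_assoc]

end Symmetric

end Summit.HodgeConjecture.HodgeConjecture.Cruxes.H413.K2E1CommutantOfMultiplicationFamily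

end
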